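import Summits.AtomisticToContinuum.HydrodynamicLimit.Theorems.BoxDissipativeWeakStrongEntropyAdmissibilitySplit
import Summits.AtomisticToContinuum.HydrodynamicLimit.Theorems.BoxDissipativeWeakStrongEntropyAdmissibilityOfOpenStubs
import Summits.AtomisticToContinuum.HydrodynamicLimit.Theorems.BoxDissipativeWeakStrongRelativeEnergyStability
import Summits.AtomisticToContinuum.HydrodynamicLimit.Theorems.BoxDissipativeWeakStrongLocalGibbsFineScalePos
import Summits.AtomisticToContinuum.HydrodynamicLimit.Theorems.BoxDissipativeWeakStrongEntropyAdmissibilityStubPathwiseSigned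
import Summits.AtomisticToContinuum.HydrodynamicLimit.Theorems.BoxDissipativeWeakStrongEntropyAdmissibilityStubMeanEntropyForcing
import Summits.AtomisticToContinuum.HydrodynamicLimit.Theorems.BoxDissipativeWeakStrongEntropyAdmissibilityStubSignedGronwall
import Summits.AtomisticToContinuum.HydrodynamicLimit.Theorems.BoxDissipativeWeakStrongEntropyAdmissibilityStubBoxL1OfVanishes
import Summits.AtomisticToContinuum.HydrodynamicLimit.Theses.BoxDissipativeWeakStrong
import HarnessLib

/-!
# Line `mean-via-weak-strong` — crux `EntropyAdmissibility` (stmt-AtomisticToContinuum-9903)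
# (strategist\'s line, PICKED and RESHAPED by lead c3, 2026-08-17)

## Idea (one paragraph)
The crux asks `E_{P_N}[(A_N + B_N)⁺] → 0` (clamp-renormalised local entropy inequality of the box fields, positive part, in
`L¹(P_N)`).  The ROUTE consumes the crux only inside the landed Březina–Feireisl relative-energy Grönwall in expectation
(`RES.stub_clampedRelEnergyGronwall`), as the forcing `E[max(K2f, 0)] → 0`, and the pathwise relative-energy inequality
`RES.sx_pathwise` is LINEAR in the entropy balance `K2f` before its last `le_max_left`.  Hence S1b (the inequality IN THE
MEAN, `stub_meanEntropyDeficit`) + `FluxClosure` (the route\'s other crux, needed by `closes` anyway) drive the SAME Grönwall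
with signed forcing `max(0, E K2f)`; the mean clamped relative energy then vanishes at every `t < T`; Step 1 of
`RES.stub_clampedRelEnergyCoercive` gives box-scale `L¹(P_N ⊗ dx)` convergence of `(ρ̂, m̂, Ê)(t)` at every `t`
(`InFrame Cptlgfs`); the landed `EABirthFS.crux_of_fineScaleLLN` returns the crux AS TYPED.  Composition landed sorry-free:
`EASplit.entropyAdmissibility_of_subs` (p171398).  RESHAPE (lead c3): the provable stub C3 `stub_meanWeakStrongFineScale`
is cut along the landed `RES` seams into four registered sub-stubs — C3a `stub_pathwiseSigned` (the pathwise inequality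
with SIGNED entropy defect), C3b `stub_meanEntropyForcing` (S1b + statics ⇒ the mean entropy forcing in `RES` vocabulary:
`K2f ∈ L¹(P_N)` and `E K2f ≤ ε` eventually), C3c `stub_signedGronwall` (the clamped Grönwall in expectation with signed
forcing), C3e `stub_boxL1OfVanishes` (Step 1 of the coercive read-out: clamped vanishing ⇒ box-scale `L¹`) — and
`stub_meanWeakStrongFineScale` is DERIVED from them sorry-free (`meanWeakStrongFineScale_of`, the bookkeeping of
`RES.RelativeEnergyStability_of` at the GIVEN kinetic window, time zero by the PROVED `LGFS.localGibbsFineScale_of_pos`).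

## Stubs (7): `stub_meanEntropyDeficit` (S1b — THE open heart, lead), `stub_fluxClosure` (= item 9902 by name),
`stub_pathwiseSigned` (C3a), `stub_meanEntropyForcing` (C3b), `stub_signedGronwall` (C3c), `stub_boxL1OfVanishes` (C3e),
and `stub_positiveTimeBoxConcentrationInBand` (S2a\' of `Lines/birth.lean`, registry continuity only; feeds only
`birth_composition`).

## Hardest stub: `stub_meanEntropyDeficit` (S1b) — the mean local second law for deterministic hard spheres at positive
times (crux-NECESSARY, p153795/p156387).  C3a–C3e are analysis of known type over the landed `RES.*` API.
-/

noncomputable section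

open MeasureTheory Filter Set
open scoped ENNReal Topology InnerProductSpace BigOperators

namespace Summit.AtomisticToContinuum.HydrodynamicLimit.Cruxes.EntropyAdmissibility.MeanViaWeakStrong

open Literature.MathematicalPhysics.KineticTheory
open Summit.AtomisticToContinuum.HydrodynamicLimit.Theses
open Summit.AtomisticToContinuum.HydrodynamicLimit.Theorems.EABirthCore (InFrame Cdef)
open Summit.AtomisticToContinuum.HydrodynamicLimit.Theorems.EABirthFS3 (Cptlgfs)

/-! ## §1 Stub signatures -/

section BDWSVocabulary

open Summit.AtomisticToContinuum.HydrodynamicLimit.Theorems.BDWS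

/-- **S1b — the annealed local entropy DEFICIT bound (THE HEART, open; shared verbatim with `Lines/birth.lean`).** In the crux's
frame: for every `ε > 0`, eventually in `N`, `E_{P_N}[A_N] + B ≤ ε`.  Necessary for the crux (`EABirthCore`), and — by this
line — sufficient for it together with `FluxClosure`.  Sources: BrezinaFeireisl2018 Def. 2.9/§3.2, Spohn1991 §3.3,
OllaVaradhanYau1993, KipnisLandim1999 Ch. 6. -/
def Sig.stub_meanEntropyDeficit : Prop :=
  BoxDissipativeWeakStrong.HsEosLowDensity →
    ∃ ηc : ℝ, 0 < ηc ∧ ∀ η₁ : ℝ, 0 < η₁ → η₁ < ηc →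
      ∀ (a₀ θ₀ : T3 → ℝ) (u₀ : T3 → V3), Continuous a₀ → Continuous θ₀ → Continuous u₀ →
        (∀ x, 0 < a₀ x) → (∀ x, 0 < θ₀ x) →
        ∃ σ₀ : ℝ, 0 < σ₀ ∧ ∀ σ : ℝ, 0 < σ → σ < σ₀ →
          ∀ (T : ℝ) (ρ θ : ℝ → T3 → ℝ) (u : ℝ → T3 → V3), IsHardSphereEulerSolution σ T ρ u θ →
            (∀ t ∈ Ico 0 T, ∀ x, ρ t x * σ ^ 3 ≤ η₁ / 2) →
            ∀ Φ : FlowFamily σ,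
              TendstoHydroFieldsAt (fun N => localGibbsLaw σ a₀ u₀ θ₀ N (Φ N)) Φ ρ u θ 0 →
              ∀ ℓ : ℕ → ℝ, (∀ N, 0 < ℓ N ∧ ℓ N ≤ 1) → Tendsto ℓ atTop (𝓝 0) →
                Tendsto (fun N : ℕ => ℓ N ^ 3 * ((N : ℝ) + 1)) atTop atTop →
                ∀ τ ∈ Ico 0 T, ∀ a b : ℝ, a < b → ∀ φ : ℝ → T3 → ℝ,
                  Literature.Analysis.FunctionSpaces.Torus.IsSmoothSpaceTimeOn (Ico 0 T) φ →
                  (∀ t ∈ Icc 0 τ, ∀ x, 0 ≤ φ t x) →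
                  ∀ ε : ℝ, 0 < ε → ∀ᶠ N : ℕ in atTop,
                    (∫ z, dynPart σ η₁ T ℓ Φ τ a b φ N z ∂(localGibbsLaw σ a₀ u₀ θ₀ N (Φ N))) +
                        initLimit σ η₁ ρ θ a b φ ≤ ε

/-- **FluxClosure as a stub (by name)** — the route's momentum-flux closure crux (item stmt-AtomisticToContinuum-9902).  This line
consumes it because the mean-form weak–strong stability needs the flux forcing `E K1a → 0`; it is discharged by `FluxClosure_holds`
the moment that crux closes and is never worked under this crux. Source: Spohn1991 II §3, BrezinaFeireisl2018 §3.2. -/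
def Sig.stub_fluxClosure : Prop :=
  BoxDissipativeWeakStrong.FluxClosure

/-- **Mean-form weak–strong stability at box scale (NEW; provable now, size M–L).** `FluxClosure → S1b →` in the crux's frame,
at every `t ∈ [0,T)` the box fields converge in `L¹(P_N ⊗ dx)` to `(ρ, ρu, E(ρ,u,θ))(t)` (= `Cptlgfs`/`RES.BoxFieldsL1At` at
every `t`).  PLAN: (i) copy `RES.sx_pathwise` (Theorems/…GronwallPathwiseB.lean) deleting its final `le_max_left`, so the
pathwise inequality carries the SIGNED `K2f`; (ii) integrate in `P_N` — `K2f N t = dynPart σ η₁ T ℓ Φ t a b θ N + initPart …`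
is integrable by the landed S1a `EABirthCore.inFrame_int` and `integrable_initPart` (the identification is the one
`RES.sx_entropyAdmissibility_temperature` already performs) — with forcing `err_N(t) = E K1a(t) + max(0, E K2f(t)) → 0` by
`FluxClosure`, by S1b at `(τ := t, φ := θ)` and the landed statics `EABirthCore.inFrame_stat`; (iii) thresholds, admissible
clamps, time zero (`RES.stub_clampedRelEnergyTimeZero` fed by the PROVED `LGFS.localGibbsFineScale_of_pos`), balance laws,
master inequality, forced Grönwall, joint measurability: verbatim `RES.RelativeEnergyStability_of`; (iv) conclusion = Step 1
(`hDlim`) of `RES.stub_clampedRelEnergyCoercive` (`co_pointwise_estimate`, `co_ae_distinctVel`, `co_pathwise_integral_le`,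
`co_tendsto_zero_of_le`), stopping before the read-out to tested fields.  Why it might fail: only Lean-side (measurability /
integrability bookkeeping of the signed forcing); the mathematics is BF18 §3.2, where the entropy inequality enters linearly.
Sources: BrezinaFeireisl2018 §3.2, FeireislLukacovaMedvidovaMizerova2018, Spohn1991. -/
def Sig.stub_meanWeakStrongFineScale : Prop :=
  BoxDissipativeWeakStrong.FluxClosure → Sig.stub_meanEntropyDeficit →
  BoxDissipativeWeakStrong.HsEosLowDensity →
    ∃ ηc : ℝ, 0 < ηc ∧ ∀ η₁ : ℝ, 0 < η₁ → η₁ < ηc →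
      ∀ (a₀ θ₀ : T3 → ℝ) (u₀ : T3 → V3), Continuous a₀ → Continuous θ₀ → Continuous u₀ →
        (∀ x, 0 < a₀ x) → (∀ x, 0 < θ₀ x) →
        ∃ σ₀ : ℝ, 0 < σ₀ ∧ ∀ σ : ℝ, 0 < σ → σ < σ₀ →
          ∀ (T : ℝ) (ρ θ : ℝ → T3 → ℝ) (u : ℝ → T3 → V3), IsHardSphereEulerSolution σ T ρ u θ →
            (∀ t ∈ Ico 0 T, ∀ x, ρ t x * σ ^ 3 ≤ η₁ / 2) →
            ∀ Φ : FlowFamily σ,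
              TendstoHydroFieldsAt (fun N => localGibbsLaw σ a₀ u₀ θ₀ N (Φ N)) Φ ρ u θ 0 →
              ∀ ℓ : ℕ → ℝ, (∀ N, 0 < ℓ N ∧ ℓ N ≤ 1) → Tendsto ℓ atTop (𝓝 0) →
                Tendsto (fun N : ℕ => ℓ N ^ 3 * ((N : ℝ) + 1)) atTop atTop →
                ∀ t ∈ Ico 0 T,
                  Tendsto (fun N : ℕ => ∫⁻ z, ENNReal.ofReal (∫ x,
                      (|boxDensity σ ℓ Φ N t z x - ρ t x| + ‖boxMomentum σ ℓ Φ N t z x - ρ t x • u t x‖ +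
                        |boxEnergy σ ℓ Φ N t z x - totalEnergyDensity (ρ t x) (u t x) (θ t x)|))
                    ∂(localGibbsLaw σ a₀ u₀ θ₀ N (Φ N))) atTop (𝓝 0)

/-- **S2a' of the LIVE line, carried verbatim (name + signature) so that registering this file keeps the live registry intact;
used only by `birth_composition`.** Positive-time box concentration in the band (open). Sources: Spohn1991 §2.3/§3.3,
OllaVaradhanYau1993 §1, KipnisLandim1999. -/
def Sig.stub_positiveTimeBoxConcentrationInBand : Prop :=
  BoxDissipativeWeakStrong.HsEosLowDensity →
    ∃ ηc : ℝ, 0 < ηc ∧ ∀ η₁ : ℝ, 0 < η₁ → η₁ < ηc →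
      ∀ (a₀ θ₀ : T3 → ℝ) (u₀ : T3 → V3), Continuous a₀ → Continuous θ₀ → Continuous u₀ →
        (∀ x, 0 < a₀ x) → (∀ x, 0 < θ₀ x) →
        ∃ σ₀ : ℝ, 0 < σ₀ ∧ ∀ σ : ℝ, 0 < σ → σ < σ₀ →
          ∀ (T : ℝ) (ρ θ : ℝ → T3 → ℝ) (u : ℝ → T3 → V3), IsHardSphereEulerSolution σ T ρ u θ →
            (∀ t ∈ Ico 0 T, ∀ x, ρ t x * σ ^ 3 ≤ η₁ / 2) →
            ∀ Φ : FlowFamily σ,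
              TendstoHydroFieldsAt (fun N => localGibbsLaw σ a₀ u₀ θ₀ N (Φ N)) Φ ρ u θ 0 →
              ∀ ℓ : ℕ → ℝ, (∀ N, 0 < ℓ N ∧ ℓ N ≤ 1) → Tendsto ℓ atTop (𝓝 0) →
                Tendsto (fun N : ℕ => ℓ N ^ 3 * ((N : ℝ) + 1)) atTop atTop →
                ∀ t ∈ Ico 0 T, ∀ G : ℝ × V3 × ℝ → ℝ, Measurable G → (∀ p, |G p| ≤ |p.1| + ‖p.2.1‖) →
                  ∀ ψ : T3 → ℝ, Continuous ψ →
                    Tendsto (fun N : ℕ => ∫⁻ z, ENNReal.ofReal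
                        |(∫ x, G (boxDensity σ ℓ Φ N t z x, boxMomentum σ ℓ Φ N t z x,
                            boxEnergy σ ℓ Φ N t z x) * ψ x) -
                          ∫ z', (∫ x, G (boxDensity σ ℓ Φ N t z' x, boxMomentum σ ℓ Φ N t z' x,
                            boxEnergy σ ℓ Φ N t z' x) * ψ x) ∂(localGibbsLaw σ a₀ u₀ θ₀ N (Φ N))|
                      ∂(localGibbsLaw σ a₀ u₀ θ₀ N (Φ N))) atTop (𝓝 0)

end BDWSVocabulary

section RESVocabulary

open Summit.AtomisticToContinuum.HydrodynamicLimit.Theorems.RES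
open Literature.Analysis.FluidPDE Literature.Analysis.FunctionSpaces
open Literature.Analysis.FluidPDE.CompressibleEuler
open Literature.Analysis.FluidPDE.CompressibleEuler.EulerPhase
open Literature.Analysis.FluidPDE.CompressibleEuler.StrongPointData

/-- **C3a — the PATHWISE clamped relative-energy inequality with SIGNED entropy defect (size M; copy of
`RES.sx_pathwise` deleting its final `le_max_left`).** Along a good orbit with pairwise distinct velocities at rational
times, `e(t) − e(0) ≤ C ∫_{(0,t]} e(s) ds + |K1-defect(t)| + K2-defect(t)` (NO positive part on the K2 defect: in the proof
of `RES.sx_pathwise` the step `hD2` is an IDENTITY before `le_max_left`).  Hypothesis bundle `S` and all other binders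
verbatim those of `RES.sx_pathwise` (Theorems/…RelativeEnergyStabilityGronwallPathwiseB.lean). Sources: BrezinaFeireisl2018 §3.2. -/
def Sig.stub_pathwiseSigned : Prop :=
  ∀ (η₀ η₁ η₁B σ T : ℝ) (F χ f : ℝ → ℝ) (ρ θ : ℝ → T3 → ℝ) (u : ℝ → T3 → V3),
    (AnalyticOnNhd ℝ F (Ioo (-η₀) η₀) ∧ EqOn hsExcessFreeEnergy F (Ico 0 η₀) ∧ 0 < η₁ ∧ η₁ ≤ η₁B ∧
      2 * η₁B < η₀ ∧ 0 < σ ∧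
      (∀ x, 0 < x → x * σ ^ 3 ≤ η₁B → f x = hsExcessFreeEnergy (x * σ ^ 3) ∧ χ x = hsCompressibility (x * σ ^ 3)) ∧
      (EulerEOS.monatomicExcess χ f).IsGibbs ∧ IsHardSphereEulerSolution σ T ρ u θ ∧
      ∀ t ∈ Ico 0 T, ∀ x, ρ t x * σ ^ 3 ≤ η₁ / 2) →
    ∀ (Φ : (N : ℕ) → HardSphereFlow (Literature.Analysis.FluidPDE.Torus.geometry (Fin 3)) (hsDiameter σ N) (N + 1))
      (ℓ : ℕ → ℝ), (∀ N, 0 < ℓ N ∧ ℓ N ≤ 1) → ∀ (N : ℕ) (z : Config (N + 1) (Fin 3) T3), z ∈ (Φ N).good →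
      (∀ q : ℚ, ∀ i j, i ≠ j → ((Φ N).flow (q : ℝ) z i).2 ≠ ((Φ N).flow (q : ℝ) z j).2) →
      BoxBalanceLawsFor σ N (Φ N) (ℓ N) z → ∀ (a b : ℝ), a ≤ b → ∀ t ∈ Ico 0 T,
      ∀ (C ρs : ℝ), ((N : ℝ) + 1)⁻¹ * (ℓ N ^ 3)⁻¹ ≤ ρs →
      (∀ s ∈ Icc 0 t, ∀ (x : T3) (v : EulerPhase),
        (v = 0 ∨ (0 < dens v ∧ 0 < ien v) ∨ (0 < dens v ∧ ien v = 0 ∧ dens v ≤ ρs)) →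
          reducedRHS (cutEOS σ η₁) (clamp a b) (pdAt T ρ u θ (s, x)) (dens v) (ien v) (mom v) ≤
            C * (pdAt T ρ u θ (s, x)).relEnergyZ (cutEOS σ η₁) (clamp a b) v) →
      clampedRelEnergyObs σ η₁ a b ρ u θ N (Φ N) (ℓ N) t z - clampedRelEnergyObs σ η₁ a b ρ u θ N (Φ N) (ℓ N) 0 z ≤
        C * (∫ s in Ioc 0 t, clampedRelEnergyObs σ η₁ a b ρ u θ N (Φ N) (ℓ N) s z) +
          |(∫ x, inner ℝ (boxState (ℓ N) ((Φ N).flow t z) x).2.1 (u t x)) -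
          (∫ x, inner ℝ (boxState (ℓ N) ((Φ N).flow 0 z) x).2.1 (u 0 x)) -
          ∫ s in Ioc 0 t, ∫ x,
            (inner ℝ (boxState (ℓ N) ((Φ N).flow s z) x).2.1
                (Torus.timeDerivWithin (Ico 0 T) u s x) +
              (∑ i, ∑ j, (boxState (ℓ N) ((Φ N).flow s z) x).2.1 i *
                  (boxState (ℓ N) ((Φ N).flow s z) x).2.1 j /
                  (boxState (ℓ N) ((Φ N).flow s z) x).1 *
                Torus.partialDeriv j (fun y => u s y i) x) +
              (boxState (ℓ N) ((Φ N).flow s z) x).1 *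
                  (2 / 3 * ((boxState (ℓ N) ((Φ N).flow s z) x).2.2 /
                      (boxState (ℓ N) ((Φ N).flow s z) x).1 -
                    ‖(boxState (ℓ N) ((Φ N).flow s z) x).2.1‖ ^ 2 /
                      (2 * (boxState (ℓ N) ((Φ N).flow s z) x).1 ^ 2))) *
                  cutCompressibility η₁ ((boxState (ℓ N) ((Φ N).flow s z) x).1 * σ ^ 3) *
                Torus.divergence (u s) x)| +
          ((∫ s in Ioc 0 t, ∫ x,
            ((boxState (ℓ N) ((Φ N).flow s z) x).1 *
                  max a (min ((cutEOS σ η₁).s (boxState (ℓ N) ((Φ N).flow s z) x).1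
              (2 / 3 * ((boxState (ℓ N) ((Φ N).flow s z) x).2.2 /
                  (boxState (ℓ N) ((Φ N).flow s z) x).1 -
                ‖(boxState (ℓ N) ((Φ N).flow s z) x).2.1‖ ^ 2 /
                  (2 * (boxState (ℓ N) ((Φ N).flow s z) x).1 ^ 2)))) b) *
                Torus.timeDerivWithin (Ico 0 T) θ s x +
              max a (min ((cutEOS σ η₁).s (boxState (ℓ N) ((Φ N).flow s z) x).1
              (2 / 3 * ((boxState (ℓ N) ((Φ N).flow s z) x).2.2 /
                  (boxState (ℓ N) ((Φ N).flow s z) x).1 -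
                ‖(boxState (ℓ N) ((Φ N).flow s z) x).2.1‖ ^ 2 /
                  (2 * (boxState (ℓ N) ((Φ N).flow s z) x).1 ^ 2)))) b) *
                inner ℝ (boxState (ℓ N) ((Φ N).flow s z) x).2.1 (Torus.gradient (θ s) x))) -
          (∫ x, (boxState (ℓ N) ((Φ N).flow t z) x).1 *
              max a (min ((cutEOS σ η₁).s (boxState (ℓ N) ((Φ N).flow t z) x).1
              (2 / 3 * ((boxState (ℓ N) ((Φ N).flow t z) x).2.2 /
                  (boxState (ℓ N) ((Φ N).flow t z) x).1 -
                ‖(boxState (ℓ N) ((Φ N).flow t z) x).2.1‖ ^ 2 /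
                  (2 * (boxState (ℓ N) ((Φ N).flow t z) x).1 ^ 2)))) b) * θ t x) +
          (∫ x, (boxState (ℓ N) ((Φ N).flow 0 z) x).1 *
              max a (min ((cutEOS σ η₁).s (boxState (ℓ N) ((Φ N).flow 0 z) x).1
              (2 / 3 * ((boxState (ℓ N) ((Φ N).flow 0 z) x).2.2 /
                  (boxState (ℓ N) ((Φ N).flow 0 z) x).1 -
                ‖(boxState (ℓ N) ((Φ N).flow 0 z) x).2.1‖ ^ 2 /
                  (2 * (boxState (ℓ N) ((Φ N).flow 0 z) x).1 ^ 2)))) b) * θ 0 x))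

/-- **C3b — the MEAN entropy forcing from S1b (size M).** `S1b →` (EOS fact `→`) in the frame of
`RES.sx_entropyAdmissibility_temperature` (K2 tested with the strong temperature `φ := θ` and the clamp `Z_{a,b}`, written
over `RES.boxState` / `RES.cutEOS` — definitionally `BDWS.dynPart σ η₁ T ℓ Φ τ a b θ N z + BDWS.initPart σ η₁ ℓ Φ a b θ N z`):
for every `N` the signed K2 functional is in `L¹(P_N)` (landed S1a `EABirthCore.inFrame_int` + `EABirthS1bNec.integrable_initPart`)
and for every `ε > 0` eventually `E_{P_N} K2f ≤ ε` (S1b at `(τ, φ := θ)`, `θ ≥ 0` by `temperature_pos`, plus the statics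
`EABirthCore.inFrame_stat`: `E|B_N − B| → 0`).  Sources: BrezinaFeireisl2018 §3.2, Spohn1991 §3.3. -/
def Sig.stub_meanEntropyForcing : Prop :=
  Sig.stub_meanEntropyDeficit → BoxDissipativeWeakStrong.HsEosLowDensity →
    ∃ ηc : ℝ, 0 < ηc ∧ ∀ η₁ : ℝ, 0 < η₁ → η₁ < ηc →
      ∀ (a₀ θ₀ : T3 → ℝ) (u₀ : T3 → V3), Continuous a₀ → Continuous θ₀ → Continuous u₀ →
        (∀ x, 0 < a₀ x) → (∀ x, 0 < θ₀ x) →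
        ∃ σ₀ : ℝ, 0 < σ₀ ∧ ∀ σ : ℝ, 0 < σ → σ < σ₀ →
          ∀ (T : ℝ) (ρ θ : ℝ → T3 → ℝ) (u : ℝ → T3 → V3), IsHardSphereEulerSolution σ T ρ u θ →
            (∀ t ∈ Ico 0 T, ∀ x, ρ t x * σ ^ 3 ≤ η₁ / 2) →
            ∀ Φ : (N : ℕ) → HardSphereFlow (Literature.Analysis.FluidPDE.Torus.geometry (Fin 3))
                (hsDiameter σ N) (N + 1),
              TendstoHydroFieldsAt (fun N => localGibbsLaw σ a₀ u₀ θ₀ N (Φ N)) Φ ρ u θ 0 →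
                ∀ ℓ : ℕ → ℝ, IsKineticWindow ℓ → ∀ τ ∈ Ico 0 T, ∀ a b : ℝ, a < b →
                  (∀ N : ℕ, Integrable (fun z => ((∫ t in Ioc 0 τ, ∫ x,
            ((boxState (ℓ N) ((Φ N).flow t z) x).1 *
                  max a (min ((cutEOS σ η₁).s (boxState (ℓ N) ((Φ N).flow t z) x).1
              (2 / 3 * ((boxState (ℓ N) ((Φ N).flow t z) x).2.2 /
                  (boxState (ℓ N) ((Φ N).flow t z) x).1 -
                ‖(boxState (ℓ N) ((Φ N).flow t z) x).2.1‖ ^ 2 /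
                  (2 * (boxState (ℓ N) ((Φ N).flow t z) x).1 ^ 2)))) b) *
                Torus.timeDerivWithin (Ico 0 T) θ t x +
              max a (min ((cutEOS σ η₁).s (boxState (ℓ N) ((Φ N).flow t z) x).1
              (2 / 3 * ((boxState (ℓ N) ((Φ N).flow t z) x).2.2 /
                  (boxState (ℓ N) ((Φ N).flow t z) x).1 -
                ‖(boxState (ℓ N) ((Φ N).flow t z) x).2.1‖ ^ 2 /
                  (2 * (boxState (ℓ N) ((Φ N).flow t z) x).1 ^ 2)))) b) *
                inner ℝ (boxState (ℓ N) ((Φ N).flow t z) x).2.1 (Torus.gradient (θ t) x))) -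
          (∫ x, (boxState (ℓ N) ((Φ N).flow τ z) x).1 *
              max a (min ((cutEOS σ η₁).s (boxState (ℓ N) ((Φ N).flow τ z) x).1
              (2 / 3 * ((boxState (ℓ N) ((Φ N).flow τ z) x).2.2 /
                  (boxState (ℓ N) ((Φ N).flow τ z) x).1 -
                ‖(boxState (ℓ N) ((Φ N).flow τ z) x).2.1‖ ^ 2 /
                  (2 * (boxState (ℓ N) ((Φ N).flow τ z) x).1 ^ 2)))) b) * θ τ x) +
          (∫ x, (boxState (ℓ N) ((Φ N).flow 0 z) x).1 *
              max a (min ((cutEOS σ η₁).s (boxState (ℓ N) ((Φ N).flow 0 z) x).1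
              (2 / 3 * ((boxState (ℓ N) ((Φ N).flow 0 z) x).2.2 /
                  (boxState (ℓ N) ((Φ N).flow 0 z) x).1 -
                ‖(boxState (ℓ N) ((Φ N).flow 0 z) x).2.1‖ ^ 2 /
                  (2 * (boxState (ℓ N) ((Φ N).flow 0 z) x).1 ^ 2)))) b) * θ 0 x)))
                    (localGibbsLaw σ a₀ u₀ θ₀ N (Φ N))) ∧
                  ∀ ε : ℝ, 0 < ε → ∀ᶠ N : ℕ in atTop,
                    (∫ z, ((∫ t in Ioc 0 τ, ∫ x,
            ((boxState (ℓ N) ((Φ N).flow t z) x).1 *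
                  max a (min ((cutEOS σ η₁).s (boxState (ℓ N) ((Φ N).flow t z) x).1
              (2 / 3 * ((boxState (ℓ N) ((Φ N).flow t z) x).2.2 /
                  (boxState (ℓ N) ((Φ N).flow t z) x).1 -
                ‖(boxState (ℓ N) ((Φ N).flow t z) x).2.1‖ ^ 2 /
                  (2 * (boxState (ℓ N) ((Φ N).flow t z) x).1 ^ 2)))) b) *
                Torus.timeDerivWithin (Ico 0 T) θ t x +
              max a (min ((cutEOS σ η₁).s (boxState (ℓ N) ((Φ N).flow t z) x).1
              (2 / 3 * ((boxState (ℓ N) ((Φ N).flow t z) x).2.2 /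
                  (boxState (ℓ N) ((Φ N).flow t z) x).1 -
                ‖(boxState (ℓ N) ((Φ N).flow t z) x).2.1‖ ^ 2 /
                  (2 * (boxState (ℓ N) ((Φ N).flow t z) x).1 ^ 2)))) b) *
                inner ℝ (boxState (ℓ N) ((Φ N).flow t z) x).2.1 (Torus.gradient (θ t) x))) -
          (∫ x, (boxState (ℓ N) ((Φ N).flow τ z) x).1 *
              max a (min ((cutEOS σ η₁).s (boxState (ℓ N) ((Φ N).flow τ z) x).1
              (2 / 3 * ((boxState (ℓ N) ((Φ N).flow τ z) x).2.2 /
                  (boxState (ℓ N) ((Φ N).flow τ z) x).1 -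
                ‖(boxState (ℓ N) ((Φ N).flow τ z) x).2.1‖ ^ 2 /
                  (2 * (boxState (ℓ N) ((Φ N).flow τ z) x).1 ^ 2)))) b) * θ τ x) +
          (∫ x, (boxState (ℓ N) ((Φ N).flow 0 z) x).1 *
              max a (min ((cutEOS σ η₁).s (boxState (ℓ N) ((Φ N).flow 0 z) x).1
              (2 / 3 * ((boxState (ℓ N) ((Φ N).flow 0 z) x).2.2 /
                  (boxState (ℓ N) ((Φ N).flow 0 z) x).1 -
                ‖(boxState (ℓ N) ((Φ N).flow 0 z) x).2.1‖ ^ 2 /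
                  (2 * (boxState (ℓ N) ((Φ N).flow 0 z) x).1 ^ 2)))) b) * θ 0 x))
                      ∂(localGibbsLaw σ a₀ u₀ θ₀ N (Φ N))) ≤ ε

/-- **C3c — the clamped relative-energy Grönwall in expectation with SIGNED entropy forcing (size L; copy of
`RES.stub_clampedRelEnergyGronwall` with four local edits).** Verbatim the statement of `RES.stub_clampedRelEnergyGronwall`
with (i) the extra first antecedent C3a and (ii) `EntropyAdmissibility` replaced by the conclusion shape of C3b.  Proof edits
in the landed 280-line proof: `hK2` := the C3b hypothesis (integrability + eventual mean bound instead of a vanishing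
`lintegral`); `hpath` uses C3a (signed K2 defect); in `hineq` integrate the signed `K2f` (integrable by `hK2.1`); forcing
`err_N(t) := E|K1_t| + max 0 (E K2f_t)`, which tends to `0` by K1 and `hK2.2`.  Sources: BrezinaFeireisl2018 §3.2. -/
def Sig.stub_signedGronwall : Prop :=
  Sig.stub_pathwiseSigned →
    (∀ (f err : ℕ → ℝ → ℝ) (τ C B : ℝ), 0 ≤ τ → 0 ≤ C →
      (∀ N, ∀ t ∈ Icc 0 τ, |f N t| ≤ B) → (∀ N, Measurable (f N)) →
      (∀ N, ∀ t ∈ Icc 0 τ, f N t ≤ f N 0 + C * (∫ s in (0:ℝ)..t, f N s) + err N t) →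
      (∀ t ∈ Icc 0 τ, Tendsto (fun N => err N t) atTop (𝓝 0)) →
      Tendsto (fun N => f N 0) atTop (𝓝 0) →
      ∀ t ∈ Icc 0 τ, ∀ ε > (0:ℝ), ∀ᶠ N in atTop, f N t ≤ ε) →
    (∀ (ε : ℝ) (n : ℕ) (Φ : HardSphereFlow (Literature.Analysis.FluidPDE.Torus.geometry (Fin 3)) ε n),
      ∃ Ψ : ℝ × Config n (Fin 3) T3 → Config n (Fin 3) T3, Measurable Ψ ∧
        ∀ (t : ℝ), ∀ z ∈ Φ.good, Ψ (t, z) = Φ.flow t z) →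
    (∀ σ : ℝ, 0 < σ → ∀ (N : ℕ)
      (Φ : HardSphereFlow (Literature.Analysis.FluidPDE.Torus.geometry (Fin 3)) (hsDiameter σ N) (N + 1))
      (l : ℝ), 0 < l → l ≤ 1 → ∀ z ∈ Φ.good, BoxBalanceLawsFor σ N Φ l z) →
    (BoxDissipativeWeakStrong.HsEosLowDensity →
      ∃ ηm : ℝ, 0 < ηm ∧ ∀ η₁ : ℝ, 0 < η₁ → η₁ < ηm → ∀ σ : ℝ, 0 < σ → CutEosMasterFor σ η₁) →
    (∀ (a₀ θ₀ : T3 → ℝ) (u₀ : T3 → V3), Continuous a₀ → Continuous θ₀ → Continuous u₀ →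
      (∀ x, 0 < a₀ x) → (∀ x, 0 < θ₀ x) → EnergyMomentFor a₀ u₀ θ₀) →
    BoxDissipativeWeakStrong.FluxClosure →
    (∃ ηc : ℝ, 0 < ηc ∧ ∀ η₁ : ℝ, 0 < η₁ → η₁ < ηc →
      ∀ (a₀ θ₀ : T3 → ℝ) (u₀ : T3 → V3), Continuous a₀ → Continuous θ₀ → Continuous u₀ →
        (∀ x, 0 < a₀ x) → (∀ x, 0 < θ₀ x) →
        ∃ σ₀ : ℝ, 0 < σ₀ ∧ ∀ σ : ℝ, 0 < σ → σ < σ₀ →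
          ∀ (T : ℝ) (ρ θ : ℝ → T3 → ℝ) (u : ℝ → T3 → V3), IsHardSphereEulerSolution σ T ρ u θ →
            (∀ t ∈ Ico 0 T, ∀ x, ρ t x * σ ^ 3 ≤ η₁ / 2) →
            ∀ Φ : (N : ℕ) → HardSphereFlow (Literature.Analysis.FluidPDE.Torus.geometry (Fin 3))
                (hsDiameter σ N) (N + 1),
              TendstoHydroFieldsAt (fun N => localGibbsLaw σ a₀ u₀ θ₀ N (Φ N)) Φ ρ u θ 0 →
                ∀ ℓ : ℕ → ℝ, IsKineticWindow ℓ → ∀ τ ∈ Ico 0 T, ∀ a b : ℝ, a < b →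
                  (∀ N : ℕ, Integrable (fun z => ((∫ t in Ioc 0 τ, ∫ x,
            ((boxState (ℓ N) ((Φ N).flow t z) x).1 *
                  max a (min ((cutEOS σ η₁).s (boxState (ℓ N) ((Φ N).flow t z) x).1
              (2 / 3 * ((boxState (ℓ N) ((Φ N).flow t z) x).2.2 /
                  (boxState (ℓ N) ((Φ N).flow t z) x).1 -
                ‖(boxState (ℓ N) ((Φ N).flow t z) x).2.1‖ ^ 2 /
                  (2 * (boxState (ℓ N) ((Φ N).flow t z) x).1 ^ 2)))) b) *
                Torus.timeDerivWithin (Ico 0 T) θ t x +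
              max a (min ((cutEOS σ η₁).s (boxState (ℓ N) ((Φ N).flow t z) x).1
              (2 / 3 * ((boxState (ℓ N) ((Φ N).flow t z) x).2.2 /
                  (boxState (ℓ N) ((Φ N).flow t z) x).1 -
                ‖(boxState (ℓ N) ((Φ N).flow t z) x).2.1‖ ^ 2 /
                  (2 * (boxState (ℓ N) ((Φ N).flow t z) x).1 ^ 2)))) b) *
                inner ℝ (boxState (ℓ N) ((Φ N).flow t z) x).2.1 (Torus.gradient (θ t) x))) -
          (∫ x, (boxState (ℓ N) ((Φ N).flow τ z) x).1 *
              max a (min ((cutEOS σ η₁).s (boxState (ℓ N) ((Φ N).flow τ z) x).1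
              (2 / 3 * ((boxState (ℓ N) ((Φ N).flow τ z) x).2.2 /
                  (boxState (ℓ N) ((Φ N).flow τ z) x).1 -
                ‖(boxState (ℓ N) ((Φ N).flow τ z) x).2.1‖ ^ 2 /
                  (2 * (boxState (ℓ N) ((Φ N).flow τ z) x).1 ^ 2)))) b) * θ τ x) +
          (∫ x, (boxState (ℓ N) ((Φ N).flow 0 z) x).1 *
              max a (min ((cutEOS σ η₁).s (boxState (ℓ N) ((Φ N).flow 0 z) x).1
              (2 / 3 * ((boxState (ℓ N) ((Φ N).flow 0 z) x).2.2 /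
                  (boxState (ℓ N) ((Φ N).flow 0 z) x).1 -
                ‖(boxState (ℓ N) ((Φ N).flow 0 z) x).2.1‖ ^ 2 /
                  (2 * (boxState (ℓ N) ((Φ N).flow 0 z) x).1 ^ 2)))) b) * θ 0 x)))
                    (localGibbsLaw σ a₀ u₀ θ₀ N (Φ N))) ∧
                  ∀ ε : ℝ, 0 < ε → ∀ᶠ N : ℕ in atTop,
                    (∫ z, ((∫ t in Ioc 0 τ, ∫ x,
            ((boxState (ℓ N) ((Φ N).flow t z) x).1 *
                  max a (min ((cutEOS σ η₁).s (boxState (ℓ N) ((Φ N).flow t z) x).1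
              (2 / 3 * ((boxState (ℓ N) ((Φ N).flow t z) x).2.2 /
                  (boxState (ℓ N) ((Φ N).flow t z) x).1 -
                ‖(boxState (ℓ N) ((Φ N).flow t z) x).2.1‖ ^ 2 /
                  (2 * (boxState (ℓ N) ((Φ N).flow t z) x).1 ^ 2)))) b) *
                Torus.timeDerivWithin (Ico 0 T) θ t x +
              max a (min ((cutEOS σ η₁).s (boxState (ℓ N) ((Φ N).flow t z) x).1
              (2 / 3 * ((boxState (ℓ N) ((Φ N).flow t z) x).2.2 /
                  (boxState (ℓ N) ((Φ N).flow t z) x).1 -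
                ‖(boxState (ℓ N) ((Φ N).flow t z) x).2.1‖ ^ 2 /
                  (2 * (boxState (ℓ N) ((Φ N).flow t z) x).1 ^ 2)))) b) *
                inner ℝ (boxState (ℓ N) ((Φ N).flow t z) x).2.1 (Torus.gradient (θ t) x))) -
          (∫ x, (boxState (ℓ N) ((Φ N).flow τ z) x).1 *
              max a (min ((cutEOS σ η₁).s (boxState (ℓ N) ((Φ N).flow τ z) x).1
              (2 / 3 * ((boxState (ℓ N) ((Φ N).flow τ z) x).2.2 /
                  (boxState (ℓ N) ((Φ N).flow τ z) x).1 -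
                ‖(boxState (ℓ N) ((Φ N).flow τ z) x).2.1‖ ^ 2 /
                  (2 * (boxState (ℓ N) ((Φ N).flow τ z) x).1 ^ 2)))) b) * θ τ x) +
          (∫ x, (boxState (ℓ N) ((Φ N).flow 0 z) x).1 *
              max a (min ((cutEOS σ η₁).s (boxState (ℓ N) ((Φ N).flow 0 z) x).1
              (2 / 3 * ((boxState (ℓ N) ((Φ N).flow 0 z) x).2.2 /
                  (boxState (ℓ N) ((Φ N).flow 0 z) x).1 -
                ‖(boxState (ℓ N) ((Φ N).flow 0 z) x).2.1‖ ^ 2 /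
                  (2 * (boxState (ℓ N) ((Φ N).flow 0 z) x).1 ^ 2)))) b) * θ 0 x))
                      ∂(localGibbsLaw σ a₀ u₀ θ₀ N (Φ N))) ≤ ε) →
    BoxDissipativeWeakStrong.HsEosLowDensity →
      ∃ ηb : ℝ, 0 < ηb ∧ ∀ η₁ : ℝ, 0 < η₁ → η₁ < ηb →
        ∀ (a₀ θ₀ : T3 → ℝ) (u₀ : T3 → V3), Continuous a₀ → Continuous θ₀ → Continuous u₀ →
          (∀ x, 0 < a₀ x) → (∀ x, 0 < θ₀ x) →
          ∃ σ₀ : ℝ, 0 < σ₀ ∧ ∀ σ : ℝ, 0 < σ → σ < σ₀ →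
            ∀ (T : ℝ) (ρ θ : ℝ → T3 → ℝ) (u : ℝ → T3 → V3), IsHardSphereEulerSolution σ T ρ u θ →
              (∀ t ∈ Ico 0 T, ∀ x, ρ t x * σ ^ 3 ≤ η₁ / 2) →
              ∀ Φ : (N : ℕ) → HardSphereFlow (Literature.Analysis.FluidPDE.Torus.geometry (Fin 3))
                  (hsDiameter σ N) (N + 1),
                TendstoHydroFieldsAt (fun N => localGibbsLaw σ a₀ u₀ θ₀ N (Φ N)) Φ ρ u θ 0 →
                  ∀ ℓ : ℕ → ℝ, IsKineticWindow ℓ →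
                    ∀ τ ∈ Ico 0 T, ∀ a b : ℝ, ClampAdmissible σ η₁ a b ρ θ τ →
                      BoxClampedRelEnergyVanishesAt σ η₁ a b a₀ u₀ θ₀ Φ ρ u θ ℓ 0 →
                        BoxClampedRelEnergyVanishesAt σ η₁ a b a₀ u₀ θ₀ Φ ρ u θ ℓ τ

/-- **C3e — clamped vanishing ⇒ box-scale `L¹(P_N ⊗ dx)` convergence (size S–M; Step 1 of
`RES.stub_clampedRelEnergyCoercive`, extracted).** Verbatim the statement of `RES.stub_clampedRelEnergyCoercive` with the
conclusion `TendstoHydroFieldsAt … t` replaced by `RES.BoxFieldsL1At σ a₀ u₀ θ₀ Φ ρ u θ ℓ t`; proof = its Step 1 (`hDlim`: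
`co_pointwise_estimate`, `co_ae_distinctVel`, `co_pathwise_integral_le`, `co_tendsto_zero_of_le`). Sources: BrezinaFeireisl2018 §3.1–3.2. -/
def Sig.stub_boxL1OfVanishes : Prop :=
  BoxDissipativeWeakStrong.HsEosLowDensity →
      ∃ ηd : ℝ, 0 < ηd ∧ ∀ η₁ : ℝ, 0 < η₁ → η₁ < ηd →
        ∀ (a₀ θ₀ : T3 → ℝ) (u₀ : T3 → V3), Continuous a₀ → Continuous θ₀ → Continuous u₀ →
          (∀ x, 0 < a₀ x) → (∀ x, 0 < θ₀ x) →
          ∀ σ : ℝ, 0 < σ → σ ≤ 1 / 2 →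
            ∀ (T : ℝ) (ρ θ : ℝ → T3 → ℝ) (u : ℝ → T3 → V3), IsHardSphereEulerSolution σ T ρ u θ →
              ∀ Φ : (N : ℕ) → HardSphereFlow (Literature.Analysis.FluidPDE.Torus.geometry (Fin 3))
                  (hsDiameter σ N) (N + 1),
                ∀ ℓ : ℕ → ℝ, IsKineticWindow ℓ →
                  ∀ t ∈ Ico 0 T, ∀ a b : ℝ, ClampAdmissible σ η₁ a b ρ θ t →
                    BoxClampedRelEnergyVanishesAt σ η₁ a b a₀ u₀ θ₀ Φ ρ u θ ℓ t →
                      BoxFieldsL1At σ a₀ u₀ θ₀ Φ ρ u θ ℓ t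

end RESVocabulary

/-! ## §2 Compositions (sorry-free) -/

/-- The three stubs of this line give the positive-time fine-scale LLN in the crux's frame. -/
theorem inFrame_ptlgfs (h₁ : Sig.stub_meanEntropyDeficit) (h₂ : Sig.stub_fluxClosure)
    (h₃ : Sig.stub_meanWeakStrongFineScale) : InFrame Cptlgfs :=
  Theorems.EASplit.inFrame_ptlgfs_of_subs h₁ h₂ h₃

/-- **THIS LINE's composition: S1b → FluxClosure → mean weak–strong stability → the crux BY NAME** (the landed split glue
`EASplit.entropyAdmissibility_of_subs`, p171398; definitional match of the stub signatures with the filed child texts). -/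
theorem EntropyAdmissibility_of (h₁ : Sig.stub_meanEntropyDeficit) (h₂ : Sig.stub_fluxClosure)
    (h₃ : Sig.stub_meanWeakStrongFineScale) : BoxDissipativeWeakStrong.EntropyAdmissibility :=
  Theorems.EASplit.entropyAdmissibility_of_subs h₁ h₂ h₃

/-- The LIVE line's composition, re-derived for the record (landed `EABirthAssembly.stub_cruxOfOpenStubs`): S1b → S2a' →
the crux, stated here through its definitional frame form `InFrame Ccrux` (`EABirthCore.entropyAdmissibility_iff_inFrame` is
`Iff.rfl`) so that the skeleton audit takes `EntropyAdmissibility_of` — THIS line — as the file's composition. -/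
theorem birth_composition (h₁ : Sig.stub_meanEntropyDeficit)
    (h₄ : Sig.stub_positiveTimeBoxConcentrationInBand) : InFrame Theorems.EABirthCore.Ccrux :=
  Theorems.EABirthAssembly.stub_cruxOfOpenStubs h₁ h₄


section Composition

open Summit.AtomisticToContinuum.HydrodynamicLimit.Theorems

/-- **C3 from its four sub-stubs (sorry-free bookkeeping; the analogue of `RES.RelativeEnergyStability_of` at the GIVEN
kinetic window).** Common band threshold `min ηe (min ηa (min ηb ηd))` over the landed `RES.stub_clampChoice` (S0),
`RES.stub_clampedRelEnergyTimeZero` (S1'), C3c (fed with C3a, the landed S-G/S-J/S-B/S-M/S-E stubs, `FluxClosure` and the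
mean forcing C3b) and C3e; common density threshold `min (1/2) (min σK σ₂)` with `σK` from the PROVED
`LGFS.localGibbsFineScale_of_pos`; admissible clamps on `[0,t]`; chain C3e ∘ C3c ∘ S1' ∘ K0 at the given `ℓ` and `t`. -/
theorem meanWeakStrongFineScale_of (hPW : Sig.stub_pathwiseSigned) (hMF : Sig.stub_meanEntropyForcing)
    (hSG : Sig.stub_signedGronwall) (hL1 : Sig.stub_boxL1OfVanishes) : Sig.stub_meanWeakStrongFineScale := by
  intro hFC hS1b hEos
  obtain ⟨ηe, hηe, H₀⟩ := RES.stub_clampChoice hEos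
  obtain ⟨ηa, hηa, H₁⟩ := RES.stub_clampedRelEnergyTimeZero hEos
  obtain ⟨ηb, hηb, H₂⟩ := hSG hPW RES.stub_forcedGronwall RES.stub_flowJointMeasurable RES.stub_boxBalanceLaws
    RES.stub_cutEosMaster RES.stub_localGibbsEnergyMoment hFC (hMF hS1b hEos) hEos
  obtain ⟨ηd, hηd, H₃⟩ := hL1 hEos
  refine ⟨min ηe (min ηa (min ηb ηd)), lt_min hηe (lt_min hηa (lt_min hηb hηd)), ?_⟩
  intro η₁ hη₁ hη₁lt a₀ θ₀ u₀ ha hθ hu hap hθp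
  have hη₁e : η₁ < ηe := lt_of_lt_of_le hη₁lt (min_le_left _ _)
  have hη₁a : η₁ < ηa := lt_of_lt_of_le hη₁lt ((min_le_right _ _).trans (min_le_left _ _))
  have hη₁b : η₁ < ηb :=
    lt_of_lt_of_le hη₁lt ((min_le_right _ _).trans ((min_le_right _ _).trans (min_le_left _ _)))
  have hη₁d : η₁ < ηd :=
    lt_of_lt_of_le hη₁lt ((min_le_right _ _).trans ((min_le_right _ _).trans (min_le_right _ _)))
  obtain ⟨σK, hσK, GK⟩ := LGFS.localGibbsFineScale_of_pos a₀ θ₀ u₀ ha hθ hu hap hθp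
  obtain ⟨σ₂, hσ₂, G₂⟩ := H₂ η₁ hη₁ hη₁b a₀ θ₀ u₀ ha hθ hu hap hθp
  refine ⟨min (1 / 2) (min σK σ₂), lt_min one_half_pos (lt_min hσK hσ₂), ?_⟩
  intro σ hσ hσlt T ρ θ u hsol hguard Φ h0 ℓ hℓ hℓ0 hℓ3 t ht
  have hσhalf : σ ≤ 1 / 2 := (lt_of_lt_of_le hσlt (min_le_left _ _)).le
  have hσK' : σ < σK := lt_of_lt_of_le hσlt ((min_le_right _ _).trans (min_le_left _ _))
  have hσ₂' : σ < σ₂ := lt_of_lt_of_le hσlt ((min_le_right _ _).trans (min_le_right _ _))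
  have hT : 0 < T := lt_of_le_of_lt ht.1 ht.2
  have hℓw : RES.IsKineticWindow ℓ := ⟨hℓ, hℓ0, hℓ3⟩
  -- admissible deep clamps on `[0,t]` (S0), restricted to `[0,0]` for the statics
  obtain ⟨a, b, hab⟩ := H₀ η₁ hη₁ hη₁e σ hσ T ρ θ u hsol hguard t ht
  have hab0 : RES.ClampAdmissible σ η₁ a b ρ θ 0 := RES.clampAdmissible_mono hab ht.1
  -- K0 at the given window (PROVED route item `LocalGibbsFineScale`)
  have hL10 : RES.BoxFieldsL1At σ a₀ u₀ θ₀ Φ ρ u θ ℓ 0 :=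
    GK σ hσ hσK' T ρ θ u hsol hT Φ h0 ℓ hℓ hℓ0 hℓ3
  -- S1': statics by dominated convergence at t = 0
  have h0rel : RES.BoxClampedRelEnergyVanishesAt σ η₁ a b a₀ u₀ θ₀ Φ ρ u θ ℓ 0 :=
    H₁ η₁ hη₁ hη₁a a₀ θ₀ u₀ ha hθ hu hap hθp σ hσ hσhalf T ρ θ u hsol hT Φ ℓ hℓw a b hab0 hL10
  -- C3c: the clamped Grönwall in expectation with signed forcing
  have htrel : RES.BoxClampedRelEnergyVanishesAt σ η₁ a b a₀ u₀ θ₀ Φ ρ u θ ℓ t :=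
    G₂ σ hσ hσ₂' T ρ θ u hsol hguard Φ h0 ℓ hℓw t ht a b hab h0rel
  -- C3e: box-scale L¹ read-out
  exact H₃ η₁ hη₁ hη₁d a₀ θ₀ u₀ ha hθ hu hap hθp σ hσ hσhalf T ρ θ u hsol Φ ℓ hℓw t ht a b hab htrel

end Composition

/-! ## §3 Stubs (the only sorries) -/

theorem stub_meanEntropyDeficit : Sig.stub_meanEntropyDeficit := by
  sorry

theorem stub_fluxClosure : Sig.stub_fluxClosure := by
  sorry

/-- C3a — LANDED (p172405, `EAMeanWSa.stub_pathwiseSigned`). -/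
theorem stub_pathwiseSigned : Sig.stub_pathwiseSigned :=
  Theorems.EAMeanWSa.stub_pathwiseSigned

/-- C3b — LANDED (p172351, `EAMeanWSb.stub_meanEntropyForcing`). -/
theorem stub_meanEntropyForcing : Sig.stub_meanEntropyForcing :=
  Theorems.EAMeanWSb.stub_meanEntropyForcing

/-- C3c — LANDED (p172725, `EAMeanWSc.stub_signedGronwall`). -/
theorem stub_signedGronwall : Sig.stub_signedGronwall :=
  Theorems.EAMeanWSc.stub_signedGronwall

/-- C3e — LANDED (p172300, `EAMeanWSe.stub_boxL1OfVanishes`). -/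
theorem stub_boxL1OfVanishes : Sig.stub_boxL1OfVanishes :=
  Theorems.EAMeanWSe.stub_boxL1OfVanishes

theorem stub_positiveTimeBoxConcentrationInBand : Sig.stub_positiveTimeBoxConcentrationInBand := by
  sorry

/-! ## §3b Derived (sorry-free given the stubs) -/

/-- C3 — mean-form weak–strong stability at box scale — DERIVED from C3a, C3b, C3c, C3e. -/
theorem stub_meanWeakStrongFineScale : Sig.stub_meanWeakStrongFineScale :=
  meanWeakStrongFineScale_of stub_pathwiseSigned stub_meanEntropyForcing stub_signedGronwall stub_boxL1OfVanishes

/-! ## §4 The crux along this line -/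

theorem EntropyAdmissibility_proof : BoxDissipativeWeakStrong.EntropyAdmissibility :=
  EntropyAdmissibility_of stub_meanEntropyDeficit stub_fluxClosure stub_meanWeakStrongFineScale

end Summit.AtomisticToContinuum.HydrodynamicLimit.Cruxes.EntropyAdmissibility.MeanViaWeakStrong

end
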